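/-
Origin: expansion seat `literature-prover-pub-hodgecm-cf-hasseminkowski-g6-0`, handover #2(e) v3 2026-08-18T08:28:21Z (`HOME/pub-hodgecm-cf-hasseminkowski-g6/handover/HodgeCM/Literature/QuadraticCharacterLocal.lean`, md5 adbae425, 603 lines);
landed by the gen-7 packager in gate run 27 as `HodgeCM/Literature/QuadraticCharacterLocal.lean` (verbatim).
-/
/-
Origin: CITED-FACT seat (4), unit `pub-hodgecm-cf-hasseminkowski-g6` (session literature-prover-pub-hodgecm-cf-hasseminkowski-g6-0),
HodgeCM publication cell, 2026-08-18.  Intended landing: `HodgeCM/Literature/QuadraticCharacterLocal.lean` (after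
`HodgeCM/Literature/QuadraticCharacter.lean`).  ADDITIVE LEAF: nothing imports it.
-/
import Summits.HodgeConjecture.HodgeCM.Literature.QuadraticCharacter_2

/-!
# The local components of the quadratic idele class character: `ε((c)_v) = (c, a)_v` at every place

`QuadraticCharacter.lean` constructs, for a number field `K` and a non-square `a ∈ K`, the quadratic
idele class character `ε = quadraticCharacter ha : C_K →* S¹` as the sign character of the index-two
subgroup `K^× N_{K(√a)/K} J ≤ 𝕀_K` (O'Meara 65:21), proves it continuous, and computes it on the
one-place idèles `(c)_v` at the REAL places `v` with `σ_v(a) < 0` (`ε((c)_v) = sgn c`).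

This file computes `ε` on the one-place idèles at EVERY place, finite or infinite:

* `finIdeleSingle K v : K_vˣ →* 𝕀_K`, `c ↦ (c)_v` (the idèle with component `c` at the finite place
  `v` and `1` elsewhere; Mathlib's `RestrictedProduct.mulSingle`), and its components;
* `hilbertSymbol_eq_one_of_forall_ne_finite` / `…_infinite`: **one Hilbert symbol is determined by
  all the others** — if `(γ, a)_u = 1` at every place `u ≠ v` then `(γ, a)_v = 1` (O'Meara 71:18,
  the vendored kernel theorem `hilbertReciprocity_holds`: the number of places with symbol `-1` is
  even, and `1` is odd);
* `finIdeleSingle_mem_quadraticNormGroup_iff`, `infIdeleSingle_mem_quadraticNormGroup_iff`: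
  **`(c)_v ∈ K^× N_{K(√a)/K} J ↔ c ∈ N(K_v(√a)^×)`** (`quadraticNormSubgroup K_v a`) at every
  finite resp. infinite place `v` — "if": a local norm at `v` padded with `1`'s is a norm idèle;
  "only if": from `(c)_v = (β)·n` the principal idèle `β⁻¹` is a local norm at every place `≠ v`,
  so by the previous item also at `v`, and then `c = β · (β⁻¹ c)` is one;
* `quadraticCharacter_finIdeleSingle_eq_one_iff`, `coe_quadraticCharacter_finIdeleSingle` (and the
  `inf` versions): **`ε((c)_v) = (c, a)_v`**, the local Hilbert symbol, at every place — this is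
  O'Meara's formula "`φ(𝔦) = ∏_{𝔭 ∈ Ω} (𝔦_𝔭, β / 𝔭)`" (proof of 71:19, p. ~203 of the 1963 edition,
  e-text chunk p0208 L27) on the generators `(c)_v`;
* the unramified dictionary at a non-dyadic place `v` with `a` a `v`-unit (O'Meara 63:16 / Example
  63:12, vendored `mem_quadraticNormSubgroup_of_valued_eq_one`, `hilbertSymbol_uniformizer_mul_iff`):
  `ε((u)_v) = 1` for every local unit `u` (`quadraticCharacter_finIdeleSingle_of_valued_eq_one`), and
  for a uniformiser `π ∈ 𝓞 K` at `v`, **`ε((π)_v) = 1 ↔ a` is a square mod `v`**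
  (`quadraticCharacter_finIdeleSingle_uniformizer_eq_one_iff`) — i.e. `ε((π)_v) = +1` at the places
  split in `K(√a)` and `-1` at the inert ones (the Frobenius description of `ε_{K(√a)/K}`);
* **O'Meara's product formula** `coe_quadraticCharacterIdele_eq_finprod_mul_prod` /
  `coe_quadraticCharacter_mk_eq_finprod_mul_prod`: for EVERY idèle `𝔦`,
  `ε(𝔦) = ∏ᶠ_{v finite} (𝔦_v, a)_v · ∏_{w ∣ ∞} (𝔦_w, a)_w`, the first product being finite
  (`finite_mulSupport_hilbertSymbol_idele`: `𝔦_v` is a local norm at almost all `v`) — verbatim the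
  DEFINITION "`φ(𝔦) = ∏_{𝔭 ∈ Ω} (𝔦_𝔭, β / 𝔭)`" of the proof of 71:19: the constructed `ε` IS O'Meara's `φ`.

Everything is a kernel theorem over the vendored cone (O'Meara 65:21, 71:18, §63); nothing is cited
as a fact and no PerL/QW8/2001 statement is used.  Not needed by PerL v5 (whose uses of `ε_{L/L₀}`,
tex ll. 260, 262, 273, 307, are restriction conditions only, closed in `QuadraticCharacterCM.lean`);
it records that the constructed `ε` has the local components of the class-field-theoretic character
of `K(√a)/K` at every place (DIVERGENCE.md cfHM6-D1/D2).

References: O. T. O'Meara, *Introduction to Quadratic Forms*, Grundlehren 117 (1963), §63B–C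
(Example 63:12, 63:16; e-text chunks p0170, p0173), §65A (Example 65:2, 65:4; p0181), §65D Prop. 65:21
(p0189 L20), §71D Thm. 71:18 (p0206 L39), proof of Thm. 71:19 (p0208 L27).
-/

set_option autoImplicit false

noncomputable section

open NumberField IsDedekindDomain
open Literature.NumberTheory.QuadraticForms
open scoped RestrictedProduct

namespace NumberField

variable (K : Type) [Field K] [NumberField K]

/-! ## One-place idèles at a finite place -/

section FinSingle

variable (v : HeightOneSpectrum (𝓞 K))

open scoped Classical in
/-- `K_v →* 𝔸_K` (multiplicative), `x ↦ (1, (x)_v)`: the adèle with finite component `x` at `v`, `1` at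
every other finite place, and `1` at the infinite places (`RestrictedProduct.mulSingle`). -/
def finAdeleSingle : v.adicCompletion K →* AdeleRing (𝓞 K) K where
  toFun x := (1, (RestrictedProduct.mulSingle
    (fun w : HeightOneSpectrum (𝓞 K) => w.adicCompletionIntegers K) v x :
      Πʳ w : HeightOneSpectrum (𝓞 K), [w.adicCompletion K, w.adicCompletionIntegers K]))
  map_one' := by
    rw [RestrictedProduct.mulSingle_one]
    rfl
  map_mul' x y := by
    rw [RestrictedProduct.mulSingle_mul]
    exact Prod.ext (mul_one (1 : InfiniteAdeleRing K)).symm rfl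

open scoped Classical in
/-- (Ported verbatim from the HodgeCMPerL package; no docstring in the source.) -/
theorem finAdeleSingle_snd_apply (x : v.adicCompletion K) (u : HeightOneSpectrum (𝓞 K)) :
    (finAdeleSingle K v x).2 u = Pi.mulSingle v x u := rfl

/-- (Ported verbatim from the HodgeCMPerL package; no docstring in the source.) -/
@[simp] theorem finAdeleSingle_snd_self (x : v.adicCompletion K) : (finAdeleSingle K v x).2 v = x := by
  classical
  rw [finAdeleSingle_snd_apply, Pi.mulSingle_eq_same]

/-- (Ported verbatim from the HodgeCMPerL package; no docstring in the source.) -/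
theorem finAdeleSingle_snd_of_ne (x : v.adicCompletion K) {u : HeightOneSpectrum (𝓞 K)} (hu : u ≠ v) :
    (finAdeleSingle K v x).2 u = 1 := by
  classical
  rw [finAdeleSingle_snd_apply, Pi.mulSingle_eq_of_ne hu]

/-- (Ported verbatim from the HodgeCMPerL package; no docstring in the source.) -/
@[simp] theorem finAdeleSingle_fst (x : v.adicCompletion K) : (finAdeleSingle K v x).1 = 1 := rfl

/-- **`(c)_v ∈ 𝕀_K`**: the idèle with component `c ∈ K_vˣ` at the finite place `v` and `1` elsewhere. -/
def finIdeleSingle : (v.adicCompletion K)ˣ →* ideleGroup K :=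
  Units.map (finAdeleSingle K v)

/-- Its class in `C_K`. -/
def finIdeleSingleClass : (v.adicCompletion K)ˣ →* IdeleClassGroup K :=
  (QuotientGroup.mk' (principalIdeles K)).comp (finIdeleSingle K v)

/-- (Ported verbatim from the HodgeCMPerL package; no docstring in the source.) -/
theorem finIdeleSingleClass_apply (c : (v.adicCompletion K)ˣ) :
    finIdeleSingleClass K v c = (QuotientGroup.mk (finIdeleSingle K v c) : IdeleClassGroup K) := rfl

/-- (Ported verbatim from the HodgeCMPerL package; no docstring in the source.) -/
theorem val_finIdeleSingle (c : (v.adicCompletion K)ˣ) :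
    ((finIdeleSingle K v c : ideleGroup K) : AdeleRing (𝓞 K) K) = finAdeleSingle K v (c : v.adicCompletion K) :=
  rfl

/-- (Ported verbatim from the HodgeCMPerL package; no docstring in the source.) -/
@[simp] theorem ideleFiniteComponent_finIdeleSingle_self (c : (v.adicCompletion K)ˣ) :
    ideleFiniteComponent K v (finIdeleSingle K v c) = c := by
  refine Units.ext ?_
  rw [val_ideleFiniteComponent, val_finIdeleSingle, finAdeleSingle_snd_self]

/-- (Ported verbatim from the HodgeCMPerL package; no docstring in the source.) -/
theorem ideleFiniteComponent_finIdeleSingle_of_ne (c : (v.adicCompletion K)ˣ) {u : HeightOneSpectrum (𝓞 K)}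
    (hu : u ≠ v) : ideleFiniteComponent K u (finIdeleSingle K v c) = 1 := by
  refine Units.ext ?_
  rw [val_ideleFiniteComponent, val_finIdeleSingle, finAdeleSingle_snd_of_ne K v _ hu, Units.val_one]

/-- (Ported verbatim from the HodgeCMPerL package; no docstring in the source.) -/
@[simp] theorem ideleInfiniteComponent_finIdeleSingle (c : (v.adicCompletion K)ˣ) (w : InfinitePlace K) :
    ideleInfiniteComponent K w (finIdeleSingle K v c) = 1 := by
  refine Units.ext ?_
  rw [val_ideleInfiniteComponent, val_finIdeleSingle, finAdeleSingle_fst, Units.val_one]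
  rfl

variable {K v}

/-- `(c)_v` is a norm idèle iff `c` is a local norm at `v`. -/
theorem finIdeleSingle_mem_normIdeles_iff {a : K} (c : (v.adicCompletion K)ˣ) :
    finIdeleSingle K v c ∈ normIdeles K a ↔
      c ∈ quadraticNormSubgroup (v.adicCompletion K) (algebraMap K _ a) := by
  rw [mem_normIdeles_iff]
  constructor
  · intro h
    simpa only [ideleFiniteComponent_finIdeleSingle_self] using h.1 v
  · intro hc
    refine ⟨fun u => ?_, fun w => ?_⟩
    · by_cases hu : u = v
      · subst hu
        rwa [ideleFiniteComponent_finIdeleSingle_self]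
      · rw [ideleFiniteComponent_finIdeleSingle_of_ne K v c hu]
        exact Subgroup.one_mem _
    · rw [ideleInfiniteComponent_finIdeleSingle]
      exact Subgroup.one_mem _

end FinSingle

/-! ## Hilbert reciprocity: one symbol is determined by all the others -/

section Reciprocity

variable {K}

/-- If `(γ, a)_u = 1` at every finite place `u ≠ v` and at every infinite place, then `(γ, a)_v = 1`
(O'Meara 71:18: the places with symbol `-1` are even in number). -/
theorem hilbertSymbol_eq_one_of_forall_ne_finite {γ a : K} (hγ : γ ≠ 0) (ha : a ≠ 0)
    (v : HeightOneSpectrum (𝓞 K))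
    (hfin : ∀ u : HeightOneSpectrum (𝓞 K), u ≠ v →
      hilbertSymbol (u.adicCompletion K) (algebraMap K _ γ) (algebraMap K _ a) = 1)
    (hinf : ∀ w : InfinitePlace K, hilbertSymbol w.Completion (algebraMap K _ γ) (algebraMap K _ a) = 1) :
    hilbertSymbol (v.adicCompletion K) (algebraMap K _ γ) (algebraMap K _ a) = 1 := by
  by_contra hne
  have hv : hilbertSymbol (v.adicCompletion K) (algebraMap K _ γ) (algebraMap K _ a) = -1 :=
    (hilbertSymbol_ne_one_iff _ _).1 hne
  obtain ⟨-, heven⟩ := hilbertReciprocity_holds K γ a hγ ha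
  have hSfin : {u : HeightOneSpectrum (𝓞 K) | hilbertSymbol (u.adicCompletion K)
      (algebraMap K _ γ) (algebraMap K _ a) = -1} = {v} := by
    ext u
    simp only [Set.mem_setOf_eq, Set.mem_singleton_iff]
    refine ⟨fun hu => ?_, fun hu => hu ▸ hv⟩
    by_contra hne'
    rw [hfin u hne'] at hu
    norm_num at hu
  have hSinf : {w : InfinitePlace K | hilbertSymbol w.Completion
      (algebraMap K _ γ) (algebraMap K _ a) = -1} = ∅ := by
    refine Set.eq_empty_iff_forall_notMem.2 fun w hw => ?_
    rw [Set.mem_setOf_eq, hinf w] at hw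
    norm_num at hw
  rw [hSfin, hSinf, Set.ncard_empty, Set.ncard_singleton, add_zero] at heven
  exact Nat.not_even_one heven

/-- If `(γ, a)_u = 1` at every finite place and at every infinite place `u ≠ w`, then `(γ, a)_w = 1`. -/
theorem hilbertSymbol_eq_one_of_forall_ne_infinite {γ a : K} (hγ : γ ≠ 0) (ha : a ≠ 0)
    (w : InfinitePlace K)
    (hfin : ∀ u : HeightOneSpectrum (𝓞 K),
      hilbertSymbol (u.adicCompletion K) (algebraMap K _ γ) (algebraMap K _ a) = 1)
    (hinf : ∀ w' : InfinitePlace K, w' ≠ w →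
      hilbertSymbol w'.Completion (algebraMap K _ γ) (algebraMap K _ a) = 1) :
    hilbertSymbol w.Completion (algebraMap K _ γ) (algebraMap K _ a) = 1 := by
  by_contra hne
  have hw : hilbertSymbol w.Completion (algebraMap K _ γ) (algebraMap K _ a) = -1 :=
    (hilbertSymbol_ne_one_iff _ _).1 hne
  obtain ⟨-, heven⟩ := hilbertReciprocity_holds K γ a hγ ha
  have hSfin : {u : HeightOneSpectrum (𝓞 K) | hilbertSymbol (u.adicCompletion K)
      (algebraMap K _ γ) (algebraMap K _ a) = -1} = ∅ := by
    refine Set.eq_empty_iff_forall_notMem.2 fun u hu => ?_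
    rw [Set.mem_setOf_eq, hfin u] at hu
    norm_num at hu
  have hSinf : {w' : InfinitePlace K | hilbertSymbol w'.Completion
      (algebraMap K _ γ) (algebraMap K _ a) = -1} = {w} := by
    ext w'
    simp only [Set.mem_setOf_eq, Set.mem_singleton_iff]
    refine ⟨fun hw' => ?_, fun hw' => hw' ▸ hw⟩
    by_contra hne'
    rw [hinf w' hne'] at hw'
    norm_num at hw'
  rw [hSfin, hSinf, Set.ncard_empty, Set.ncard_singleton, zero_add] at heven
  exact Nat.not_even_one heven

end Reciprocity

/-! ## `(c)_v ∈ K^× N J ↔ c ∈ N(K_v(√a)^×)` and `ε((c)_v) = (c, a)_v` at a finite place -/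

section Finite

variable {K}
variable {a : K}

/-- **`(c)_v ∈ K^× N_{K(√a)/K} J ↔ c` is a local norm at `v`** (finite `v`, `a ≠ 0`). -/
theorem finIdeleSingle_mem_quadraticNormGroup_iff (ha0 : a ≠ 0) {v : HeightOneSpectrum (𝓞 K)}
    (c : (v.adicCompletion K)ˣ) :
    finIdeleSingle K v c ∈ quadraticNormGroup K a ↔
      c ∈ quadraticNormSubgroup (v.adicCompletion K) (algebraMap K _ a) := by
  classical
  refine ⟨fun hmem => ?_, fun hc =>
    normIdeles_le_quadraticNormGroup K a ((finIdeleSingle_mem_normIdeles_iff c).2 hc)⟩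
  obtain ⟨p, hp, n, hn, hpn⟩ := Subgroup.mem_sup.1 hmem
  obtain ⟨β, rfl⟩ := hp
  have hγ0 : ((β⁻¹ : Kˣ) : K) ≠ 0 := (β⁻¹).ne_zero
  have hn_eq : n = Units.map (algebraMap K (AdeleRing (𝓞 K) K) : K →* AdeleRing (𝓞 K) K) β⁻¹ *
      finIdeleSingle K v c := by
    rw [map_inv, ← hpn, inv_mul_cancel_left]
  have hN := mem_normIdeles_iff.1 hn
  -- components of the norm idèle `n = (β⁻¹)·(c)_v`
  have hnu : ∀ u : HeightOneSpectrum (𝓞 K), u ≠ v →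
      (ideleFiniteComponent K u n : u.adicCompletion K) = algebraMap K _ ((β⁻¹ : Kˣ) : K) := fun u hu => by
    rw [hn_eq, map_mul, ideleFiniteComponent_finIdeleSingle_of_ne K v c hu, mul_one,
      ideleFiniteComponent_principal, val_unitsMap_algebraMap]
  have hnw : ∀ w : InfinitePlace K,
      (ideleInfiniteComponent K w n : w.Completion) = algebraMap K _ ((β⁻¹ : Kˣ) : K) := fun w => by
    rw [hn_eq, map_mul, ideleInfiniteComponent_finIdeleSingle, mul_one, ideleInfiniteComponent_principal,
      val_unitsMap_algebraMap]
  have hnv : ideleFiniteComponent K v n =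
      Units.map (algebraMap K (v.adicCompletion K) : K →* _) β⁻¹ * c := by
    rw [hn_eq, map_mul, ideleFiniteComponent_principal, ideleFiniteComponent_finIdeleSingle_self]
  -- Hilbert symbols `(β⁻¹, a)_u = 1` away from `v`
  have hfin : ∀ u : HeightOneSpectrum (𝓞 K), u ≠ v →
      hilbertSymbol (u.adicCompletion K) (algebraMap K _ ((β⁻¹ : Kˣ) : K)) (algebraMap K _ a) = 1 := by
    intro u hu
    haveI : CharZero (u.adicCompletion K) := charZero_of_injective_algebraMap (algebraMap K _).injective
    have h2 := (hilbertSymbol_eq_one_iff_mem_quadraticNormSubgroup (F := u.adicCompletion K)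
      ((map_ne_zero (algebraMap K (u.adicCompletion K))).2 ha0) (ideleFiniteComponent K u n)).2 (hN.1 u)
    rwa [hnu u hu] at h2
  have hinf : ∀ w : InfinitePlace K,
      hilbertSymbol w.Completion (algebraMap K _ ((β⁻¹ : Kˣ) : K)) (algebraMap K _ a) = 1 := by
    intro w
    haveI : CharZero w.Completion := charZero_of_injective_algebraMap (algebraMap K _).injective
    have h2 := (hilbertSymbol_eq_one_iff_mem_quadraticNormSubgroup (F := w.Completion)
      ((map_ne_zero (algebraMap K w.Completion)).2 ha0) (ideleInfiniteComponent K w n)).2 (hN.2 w)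
    rwa [hnw w] at h2
  -- hence also at `v` (reciprocity), i.e. `β⁻¹` is a local norm at `v`; and so is `β⁻¹ c`
  haveI : CharZero (v.adicCompletion K) := charZero_of_injective_algebraMap (algebraMap K _).injective
  have ha0v : algebraMap K (v.adicCompletion K) a ≠ 0 := (map_ne_zero _).2 ha0
  have hγN : Units.map (algebraMap K (v.adicCompletion K) : K →* _) β⁻¹ ∈
      quadraticNormSubgroup (v.adicCompletion K) (algebraMap K _ a) := by
    refine (hilbertSymbol_eq_one_iff_mem_quadraticNormSubgroup ha0v _).1 ?_
    rw [val_unitsMap_algebraMap]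
    exact hilbertSymbol_eq_one_of_forall_ne_finite hγ0 ha0 v hfin hinf
  have hγcN := hN.1 v
  rw [hnv] at hγcN
  have h := Subgroup.mul_mem _ (Subgroup.inv_mem _ hγN) hγcN
  rwa [inv_mul_cancel_left] at h

variable (ha : ¬ IsSquare a)

/-- **`ε((c)_v) = 1 ↔ (c, a)_v = 1`** at a finite place `v`. -/
theorem quadraticCharacter_finIdeleSingle_eq_one_iff {v : HeightOneSpectrum (𝓞 K)} (c : (v.adicCompletion K)ˣ) :
    quadraticCharacter ha (finIdeleSingleClass K v c) = 1 ↔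
      hilbertSymbol (v.adicCompletion K) (c : v.adicCompletion K) (algebraMap K _ a) = 1 := by
  have ha0 : a ≠ 0 := fun h => ha (h ▸ IsSquare.zero)
  haveI : CharZero (v.adicCompletion K) := charZero_of_injective_algebraMap (algebraMap K _).injective
  rw [finIdeleSingleClass_apply, quadraticCharacter_mk_eq_one_iff, finIdeleSingle_mem_quadraticNormGroup_iff ha0,
    hilbertSymbol_eq_one_iff_mem_quadraticNormSubgroup ((map_ne_zero _).2 ha0)]

/-- **`ε((c)_v) = (c, a)_v`** (as complex numbers `±1`) at a finite place `v` — O'Meara's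
`φ(𝔦) = ∏_𝔭 (𝔦_𝔭, β / 𝔭)` on the generator `𝔦 = (c)_v`. -/
theorem coe_quadraticCharacter_finIdeleSingle {v : HeightOneSpectrum (𝓞 K)} (c : (v.adicCompletion K)ˣ) :
    ((quadraticCharacter ha (finIdeleSingleClass K v c) : Circle) : ℂ) =
      (hilbertSymbol (v.adicCompletion K) (c : v.adicCompletion K) (algebraMap K _ a) : ℂ) := by
  rcases hilbertSymbol_eq_one_or_eq_neg_one (c : v.adicCompletion K) (algebraMap K _ a) with h | h
  · rw [h, (quadraticCharacter_finIdeleSingle_eq_one_iff ha c).2 h, Circle.coe_one, Int.cast_one]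
  · have hne : quadraticCharacter ha (finIdeleSingleClass K v c) ≠ 1 := fun h1 => by
      have h2 := (quadraticCharacter_finIdeleSingle_eq_one_iff ha c).1 h1
      rw [h] at h2
      norm_num at h2
    have hval : quadraticCharacter ha (finIdeleSingleClass K v c) = -1 := by
      rw [finIdeleSingleClass_apply, quadraticCharacter_mk]
      refine quadraticCharacterIdele_apply_of_not_mem ha fun hmem => hne ?_
      rw [finIdeleSingleClass_apply, quadraticCharacter_mk_eq_one_iff]
      exact hmem
    rw [h, hval, Circle.coe_neg, Circle.coe_one, Int.cast_neg, Int.cast_one]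

end Finite

/-! ## The same at an infinite place -/

section Infinite

variable {K}
variable {a : K}


-- port_pkg: scope closed for this part
end Infinite
end NumberField
end
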